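import Summits.QuantumFields.BalabanUV.Beta.GAN24.WSlotT2TablesAn1
import Summits.QuantumFields.BalabanUV.Beta.HessKerSlotCurrency

/-!
# `BalabanUV.Gaps.D1PinnedClosedFormHalves` — cell pub-balaban-gaps, row (D1), seat g1-p1: AT THE PINNED LITERAL `JsBalAn1` THE CLOSED-FORM LIMIT `M∞`
# (gan24-p1's limit-kernel second moment; `= CauchyRate.lim β⁰` by `Gaps/D1PinnedLimitClosedForm`) IS THE SUM OF ITS TWO HALVES — the TADPOLE half
# `secondMoment (hessKer (axDressK Lc K∞) 0 W∞)` and the BUBBLE half `secondMoment (hessKer (axDressK Lc K∞) (axVertexOfK K∞ Lc S∞) 0)` — each the second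
# moment of an exponentially localised kernel, hypothesis-free; and the constructed limit primitives `(K∞, S∞, W∞)` carry the three row shapes

HONEST FRAMING (cell rule, page 1 of everything): bookkeeping BY NAME over tree theorems — gan24-p1's hypothesis-free rows for the pinned literal
(`GAN24.WSlotT2TablesAn1.hW_hWall_three_an1At_pinned`, `GAN24.StencilSlotSAllThree.hS_hSall_three`, `GAN24.KSlotAssembly.convCKWall_holds`, merged by asym1's
`HessKerConvCKPlug.exists_merged_rows`), asym1's half-kernel ladder `HessKerSlotCurrency` (`secondMoment_eq_halves`, `uniformDecay_halfW_of_entrywise`, `uniformDecay_halfS`, `hessKer_zeroV` ∕ `hessKer_zeroW`) and `HessKerDressedCauchy.axVertexOfK_eq_vertexOfK_coProj` ∕ `AxialDressing.decays_axDressK` ∕ `locStencil_coProj` at the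
CONSTRUCTED limits (`HessKerDressedLimit.decays_limMKerOf` ∕ `locStencil_limStOf` ∕ `vertexFamily₂_limTabOf` and their rate twins), Mathlib's uniqueness of limits
(`Filter.Tendsto.limUnder_eq`), and g1-p3's pinned files `Gaps/CapTailPinnedLimitSign` ∕ `Gaps/CapTailEndNecessity`.  NOTHING of Bałaban's is asserted beyond print;
[Balaban1987RG1] Thm 2 is UNPROVED IN PRINT; the VALUE of `M∞` is NOT computed here (that computation — `M∞ = (11N²∕12π²)·log Lc` for Bałaban's colour data — IS
the wall (D1) at this literal, the β sub-cell's identification `hident` ∕ road A2's «second half») and its SIGN is NOT decided here; the family `JsBalAn1 …` does NOT depend on the numeral `N` and its colour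
data `cE cVH cΛ cB Tc` are free reals ∕ a free table ((P6), pinned last); 0 coefficients certified; (D1) NOT discharged at any literal; 0∕4 row-D1 binders; NOT
`BetaPertH`, NOT the continuum limit, NOT Clay.  HONEST DEPENDENCY (b2b cell, verbatim): «continuum YM on T⁴ ⇐ BetaPertH ∧ nine spine estimates (0/9 proved);
BetaPertH ⇐ (D1) ∧ (D4) ∧ CAP+tail; G-an2-4 gates asym, D1 and NE2/3/4.»

WHY (row (D1); census rows 58 ∕ 62).  `Gaps/D1PinnedLimitClosedForm` (this seat, GEN 9) typed the bridge `CauchyRate.lim β⁰(JsBalAn1) = M∞` and the T⁴ headline from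
`0 < M∞`.  The kernel whose second moment `M∞` is reads `hessKer A V W μ ν z = ½·Tr[A ∘ W^{μν}(0,z)] − ½·Tr[(A∘V^μ(0))(A∘V^ν(z))]` (asym1's
`hessKer_zeroV` ∕ `hessKer_zeroW` ∕ `hessKer_eq_halfW_add_halfS`): a TADPOLE word on the second-order tables and a BUBBLE word on the first-order vertex.
Census row 58 (gen 8) records why the SIGN of `M∞` is not a structural (PSD ∕ Ward) consequence: the two words carry opposite structural signs.  This
file makes the two words of `M∞` typed, finite objects at the pinned literal — `M∞ = M∞ᵂ + M∞ˢ` with `M∞ᵂ := secondMoment (hessKer A∞ 0 W∞) μ ν`,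
`M∞ˢ := secondMoment (hessKer A∞ V∞ 0) μ ν`, `A∞ = axDressK Lc K∞`, `V∞ = axVertexOfK K∞ Lc S∞` — so that «tadpole beats bubble», `−M∞ˢ < M∞ᵂ`, is
the pinned literal's END-grade bit written on its two words; and it records that the CONSTRUCTED limit primitives themselves satisfy the three row
shapes (`Decays K∞`, `LocStencil S∞`, `VertexFamily₂ W∞`) with a common window — the letters any consumer of `(K∞, S∞, W∞)` needs.

CONTENT (all [folklore]; no `def`, no `def … : Prop`, nothing cited as a hypothesis, 0 sorry; `2 ≤ Lc`, root `r ∈ box 4 Lc`, any colour data, any channel):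
* §1 **`exists_rows_limits_pinned`** — `∃ C δK Cs δS Cw δW R, 0 < R ∧ R < δK ∧ R∕2 < δS ∧ R < δW ∧ Decays K∞ C δK ∧ LocStencil S∞ Cs δS ∧ VertexFamily₂ W∞ Lc Cw δW`
  (gan24-p1's rows merged by `exists_merged_rows`, passed to the limits by `decays_limMKerOf` ∕ `locStencil_limStOf` ∕ `vertexFamily₂_limTabOf`).
* §2 **`exists_decay510_halfW_pinned`**, **`exists_decay510_halfS_pinned`** — each half of the limit kernel is `Decay510` in the `(μ,ν)` entry (some constant,
  some rate `> 0`): asym1's `uniformDecay_halfW_of_entrywise` ∕ `uniformDecay_halfS` at the CONSTANT families, the bubble half through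
  `axVertexOfK_eq_vertexOfK_coProj` + `vertexFamilyW_vertexOfK`.
* §3 **`closedForm_eq_halves_pinned`** — `M∞ = secondMoment (hessKer A∞ 0 W∞) μ ν + secondMoment (hessKer A∞ V∞ 0) μ ν` (asym1's `secondMoment_eq_halves`,
  summability from §2 by `summable_coord2_mul_of_decay510`).
READING (zero classification weight): neither half is computed or signed here; with `Gaps/D1PinnedLimitClosedForm` the END-grade bit at the pinned literal reads
`0 < M∞ᵂ + M∞ˢ`; the VALUE content of (D1) reads `M∞ᵂ + M∞ˢ = (11N²∕12π²)·log Lc`.  Nothing of (D1) is discharged.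

ABSOLUTE RULE (cell charter, verbatim): «No internally-minted statement may enter as a cited fact. Every hypothesis is either kernel-proved in this
package or a verbatim quotation of a PUBLISHED theorem with page reference. The manuscript(s) under audit are NOT citable for their own disputed
steps — they are the thing under adjudication; programme-internal (2001/route/tribunal) claims are never citable.»

Provenance: cell pub-balaban-gaps, seat g1-p1 GEN 9 (prover-pub-balaban-gaps-g1-p1-g9-0), 2026-08-23; imports gan24-p1's `GAN24.WSlotT2TablesAn1` and asym1's
`HessKerSlotCurrency` ONLY; every tree theorem used BY NAME; no existing file touched; independent of `Gaps/D1PinnedLimitClosedForm` (no import either way).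
-/

noncomputable section

open Finset Filter Topology
open scoped BigOperators
open Literature.MathematicalPhysics.QuantumFieldTheory
open Literature.MathematicalPhysics.QuantumFieldTheory.Balaban1983to89
open Literature.MathematicalPhysics.QuantumFieldTheory.Balaban1983to89.FlowStep
open Literature.MathematicalPhysics.QuantumFieldTheory.Balaban1983to89.FlowStepRuns
open Literature.MathematicalPhysics.QuantumFieldTheory.Balaban1983to89.DagBinding
open Literature.MathematicalPhysics.QuantumFieldTheory.Balaban1983to89.Beta
open AffineAveraging (box toSite)
open AveragingContoursRooted (ctrOff ctrOff_mem_box)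
open ExpKernelCalculus (MKer VertexFamily₂ hessKer)
open OneStepResolventKernel (Fib LocStencil)
open OneStepKernelFamily (KInvStep D1Drift TbalOf)
open RemainderConstAllScales (AllScalesSeq)
open RateCertificate (GeomRate CauchyRate)
open AxialDressing (axDressK axVertexOfK)
open BalabanStepJetsSucc (JsBal0Of JsBalOf)
open BalabanStepW2 (T2Of T2Of_loc CwOf δwOf δwOf_pos WbalOf_loc₂ WbalOf)
open AveragingMixedJetTables (vh₂SAt mixFFAt)
open HessKerDressedLimit (limMKerOf limStOf limTabOf decays_limMKerOf decays_sub_limMKerOf locStencil_limStOf locStencil_sub_limStOf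
  vertexFamily₂_limTabOf vertexFamily₂_sub_limTabOf)
open Summit.QuantumFields.BalabanUV.Beta.HessKerDressedUnits (unitK unitS unitW)
open Summit.QuantumFields.BalabanUV.Beta.MixedJetTablesPlug (hmix_an1 hB_an1 JsBalAn1 JsBalAn1Ctr)
open Summit.QuantumFields.BalabanUV.Beta.GAN24.CombesThomas (sfStep smStep sfStep_ne_zero smStep_ne_zero)
open Summit.QuantumFields.BalabanUV.Beta.GAN24.StencilSlotOfE3 (one_le_of_two_le)
open ExpKernelCalculus (Decays)
open OneStepKernelFamily (vertexOfK)
open B12Sec2to5 (Decay510)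
open LimitRate (UniformDecay)
open AxialDressing (decays_axDressK locStencil_coProj cAx)
open HessKerDressedCauchy (axVertexOfK_eq_vertexOfK_coProj)
open HessKerSchur (colW_of_decays locStencilW_of_locStencil vertexFamily₂W_of_vertexFamily₂ vertexFamilyW_vertexOfK)
open DecimatedMomentLimit (summable_coord2_mul_of_decay510)
open Summit.QuantumFields.BalabanUV.Beta.GAN24.KSlotAssembly (convCKWall_holds)
open Summit.QuantumFields.BalabanUV.Beta.GAN24.StencilSlotSAllThree (hS_hSall_three)
open Summit.QuantumFields.BalabanUV.Beta.HessKerConvCKPlug (exists_merged_rows)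
open Summit.QuantumFields.BalabanUV.Beta.GAN24.WSlotT2TablesAn1 (hW_hWall_three_an1At_pinned)
open Summit.QuantumFields.BalabanUV.Beta.HessKerSlotCurrency (secondMoment_eq_halves uniformDecay_halfW_of_entrywise uniformDecay_halfS)

namespace Summit.QuantumFields.BalabanUV.Gaps.D1PinnedClosedFormHalves

variable {Lc : ℕ} [NeZero Lc] {r : Fin (3 + 1) → ℕ}

/-! ## §1 The constructed limit primitives carry the three row shapes, hypothesis-free -/

/-- [folklore] **THE CONSTRUCTED LIMIT PRIMITIVES `(K∞, S∞, W∞)` OF THE PINNED LITERAL SATISFY THE THREE ROW SHAPES WITH A COMMON WINDOW**: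
`∃ C δK Cs δS Cw δW R, 0 < R ∧ R < δK ∧ R∕2 < δS ∧ R < δW ∧ Decays K∞ C δK ∧ LocStencil S∞ Cs δS ∧ VertexFamily₂ W∞ Lc Cw δW` — gan24-p1's W-pair ∕ S-rows ∕
K-rows merged by asym1's `exists_merged_rows` and passed to the limits (`decays_limMKerOf`, `locStencil_limStOf`, `vertexFamily₂_limTabOf`). -/
theorem exists_rows_limits_pinned (hLc : 2 ≤ Lc) (hr : r ∈ box (3 + 1) Lc) (cE cVH cΛ cB : ℝ)
    (Tc : Fin 4 → Fin 4 → Fin 4 → Fin 4 → ℝ) :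
    ∃ C δK Cs δS Cw δW R : ℝ, 0 < R ∧ R < δK ∧ R / 2 < δS ∧ R < δW ∧
      Decays (limMKerOf fun j => unitK (sfStep Lc j) (smStep 3 Lc j) (KInvStep (d := 3) Lc j)) C δK ∧
      LocStencil (limStOf fun j => unitS (sfStep Lc j) (smStep 3 Lc j) (JsBal0Of (one_le_of_two_le hLc) cE cVH cΛ (WbalOf 3 Lc cE cVH cΛ (T2Of 3 Lc cE cVH cΛ ((Lc : ℝ) ^ (2 * (3 + 1))) cB Tc (vh₂SAt (toSite r) Lc) (mixFFAt (toSite r) Lc)) (mixFFAt (toSite r) Lc))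
        (CwOf (one_le_of_two_le hLc) cE cVH cΛ (T2Of_loc (one_le_of_two_le hLc) cE cVH cΛ ((Lc : ℝ) ^ (2 * (3 + 1))) cB Tc (hB_an1 (one_le_of_two_le hLc) hr) (hmix_an1 (one_le_of_two_le hLc) hr)) (hmix_an1 (one_le_of_two_le hLc) hr)) (δwOf (one_le_of_two_le hLc) cE cVH cΛ (T2Of_loc (one_le_of_two_le hLc) cE cVH cΛ ((Lc : ℝ) ^ (2 * (3 + 1))) cB Tc (hB_an1 (one_le_of_two_le hLc) hr) (hmix_an1 (one_le_of_two_le hLc) hr)) (hmix_an1 (one_le_of_two_le hLc) hr))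
        (δwOf_pos (one_le_of_two_le hLc) cE cVH cΛ (T2Of_loc (one_le_of_two_le hLc) cE cVH cΛ ((Lc : ℝ) ^ (2 * (3 + 1))) cB Tc (hB_an1 (one_le_of_two_le hLc) hr) (hmix_an1 (one_le_of_two_le hLc) hr)) (hmix_an1 (one_le_of_two_le hLc) hr)) (WbalOf_loc₂ (one_le_of_two_le hLc) cE cVH cΛ (T2Of_loc (one_le_of_two_le hLc) cE cVH cΛ ((Lc : ℝ) ^ (2 * (3 + 1))) cB Tc (hB_an1 (one_le_of_two_le hLc) hr) (hmix_an1 (one_le_of_two_le hLc) hr)) (hmix_an1 (one_le_of_two_le hLc) hr)) j).S) Cs δS ∧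
      VertexFamily₂ (limTabOf fun j => unitW (sfStep Lc j) (smStep 3 Lc j) (WbalOf 3 Lc cE cVH cΛ (T2Of 3 Lc cE cVH cΛ ((Lc : ℝ) ^ (2 * (3 + 1))) cB Tc (vh₂SAt (toSite r) Lc) (mixFFAt (toSite r) Lc)) (mixFFAt (toSite r) Lc) j)) Lc Cw δW := by
  obtain ⟨Cw, cW, θW, δW, hθW0, hθW1, hδW, hW₂, hW₂all⟩ := hW_hWall_three_an1At_pinned hLc hr cE cVH cΛ cB Tc
  obtain ⟨Cs, cS, θS, δS, hθS0, hθS1, hδS, hS, hSall⟩ := hS_hSall_three hLc cE cVH cΛ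
    (WbalOf 3 Lc cE cVH cΛ (T2Of 3 Lc cE cVH cΛ ((Lc : ℝ) ^ (2 * (3 + 1))) cB Tc (vh₂SAt (toSite r) Lc) (mixFFAt (toSite r) Lc)) (mixFFAt (toSite r) Lc)) _ _
    (δwOf_pos (one_le_of_two_le hLc) cE cVH cΛ (T2Of_loc (one_le_of_two_le hLc) cE cVH cΛ ((Lc : ℝ) ^ (2 * (3 + 1))) cB Tc (hB_an1 (one_le_of_two_le hLc) hr) (hmix_an1 (one_le_of_two_le hLc) hr)) (hmix_an1 (one_le_of_two_le hLc) hr))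
    (WbalOf_loc₂ (one_le_of_two_le hLc) cE cVH cΛ (T2Of_loc (one_le_of_two_le hLc) cE cVH cΛ ((Lc : ℝ) ^ (2 * (3 + 1))) cB Tc (hB_an1 (one_le_of_two_le hLc) hr) (hmix_an1 (one_le_of_two_le hLc) hr)) (hmix_an1 (one_le_of_two_le hLc) hr))
  obtain ⟨C, δK, cK, θ, R, hR, hRK, hRS, hRW, hθ0, hθ1, hK, hKall, hSall', hWall'⟩ :=
    exists_merged_rows (Lc := Lc) (convCKWall_holds (Lc := Lc) hLc)
      (S := fun j => unitS (sfStep Lc j) (smStep 3 Lc j) (JsBal0Of (one_le_of_two_le hLc) cE cVH cΛ (WbalOf 3 Lc cE cVH cΛ (T2Of 3 Lc cE cVH cΛ ((Lc : ℝ) ^ (2 * (3 + 1))) cB Tc (vh₂SAt (toSite r) Lc) (mixFFAt (toSite r) Lc)) (mixFFAt (toSite r) Lc))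
        (CwOf (one_le_of_two_le hLc) cE cVH cΛ (T2Of_loc (one_le_of_two_le hLc) cE cVH cΛ ((Lc : ℝ) ^ (2 * (3 + 1))) cB Tc (hB_an1 (one_le_of_two_le hLc) hr) (hmix_an1 (one_le_of_two_le hLc) hr)) (hmix_an1 (one_le_of_two_le hLc) hr)) (δwOf (one_le_of_two_le hLc) cE cVH cΛ (T2Of_loc (one_le_of_two_le hLc) cE cVH cΛ ((Lc : ℝ) ^ (2 * (3 + 1))) cB Tc (hB_an1 (one_le_of_two_le hLc) hr) (hmix_an1 (one_le_of_two_le hLc) hr)) (hmix_an1 (one_le_of_two_le hLc) hr))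
        (δwOf_pos (one_le_of_two_le hLc) cE cVH cΛ (T2Of_loc (one_le_of_two_le hLc) cE cVH cΛ ((Lc : ℝ) ^ (2 * (3 + 1))) cB Tc (hB_an1 (one_le_of_two_le hLc) hr) (hmix_an1 (one_le_of_two_le hLc) hr)) (hmix_an1 (one_le_of_two_le hLc) hr)) (WbalOf_loc₂ (one_le_of_two_le hLc) cE cVH cΛ (T2Of_loc (one_le_of_two_le hLc) cE cVH cΛ ((Lc : ℝ) ^ (2 * (3 + 1))) cB Tc (hB_an1 (one_le_of_two_le hLc) hr) (hmix_an1 (one_le_of_two_le hLc) hr)) (hmix_an1 (one_le_of_two_le hLc) hr)) j).S)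
      (W := fun j => unitW (sfStep Lc j) (smStep 3 Lc j) (WbalOf 3 Lc cE cVH cΛ (T2Of 3 Lc cE cVH cΛ ((Lc : ℝ) ^ (2 * (3 + 1))) cB Tc (vh₂SAt (toSite r) Lc) (mixFFAt (toSite r) Lc)) (mixFFAt (toSite r) Lc) j))
      hSall hW₂all hδS hδW hθS0 hθS1 hθW0 hθW1
  exact ⟨C, δK, Cs, δS, Cw, δW, R, hR, by linarith, hRS, hRW, decays_limMKerOf hK hKall hθ1, locStencil_limStOf hS hSall' hθ1,
    vertexFamily₂_limTabOf hW₂ hWall' hθ1⟩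

/-! ## §2 Each half of the limit kernel is exponentially localised in the `(μ,ν)` entry -/

/-- [folklore] **THE TADPOLE HALF OF THE LIMIT KERNEL IS `Decay510`** (some constant, some rate `> 0`): asym1's `uniformDecay_halfW_of_entrywise` at the CONSTANT
families `(axDressK Lc K∞, W∞)` with §1's letters (`decays_axDressK` for the dressed leg). -/
theorem exists_decay510_halfW_pinned (hLc : 2 ≤ Lc) (hr : r ∈ box (3 + 1) Lc) (cE cVH cΛ cB : ℝ)
    (Tc : Fin 4 → Fin 4 → Fin 4 → Fin 4 → ℝ) (μ ν : Fin 4) :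
    ∃ C δ : ℝ, 0 < δ ∧ Decay510 (hessKer (axDressK Lc (limMKerOf fun j => unitK (sfStep Lc j) (smStep 3 Lc j) (KInvStep (d := 3) Lc j))) 0
      (limTabOf fun j => unitW (sfStep Lc j) (smStep 3 Lc j) (WbalOf 3 Lc cE cVH cΛ (T2Of 3 Lc cE cVH cΛ ((Lc : ℝ) ^ (2 * (3 + 1))) cB Tc (vh₂SAt (toSite r) Lc) (mixFFAt (toSite r) Lc)) (mixFFAt (toSite r) Lc) j)) μ ν) C δ := by
  obtain ⟨C, δK, Cs, δS, Cw, δW, R, hR, hRK, hRS, hRW, hK, hS, hW⟩ := exists_rows_limits_pinned hLc hr cE cVH cΛ cB Tc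
  have hδK : 0 < δK := hR.trans hRK
  have hA := decays_axDressK (one_le_of_two_le hLc) hK hδK.le
  have hU := uniformDecay_halfW_of_entrywise (A := fun _ : ℕ => axDressK Lc (limMKerOf fun j => unitK (sfStep Lc j) (smStep 3 Lc j) (KInvStep (d := 3) Lc j)))
    (W := fun _ : ℕ => limTabOf fun j => unitW (sfStep Lc j) (smStep 3 Lc j) (WbalOf 3 Lc cE cVH cΛ (T2Of 3 Lc cE cVH cΛ ((Lc : ℝ) ^ (2 * (3 + 1))) cB Tc (vh₂SAt (toSite r) Lc) (mixFFAt (toSite r) Lc)) (mixFFAt (toSite r) Lc) j))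
    (N := Lc) (fun _ => hA) (fun _ => hW) hR.le hRK hRW μ ν
  have hLc0 : (0 : ℝ) < (Lc : ℝ) := by exact_mod_cast (lt_of_lt_of_le zero_lt_two hLc)
  exact ⟨_, R * Lc, mul_pos hR hLc0, hU 0⟩

/-- [folklore] **THE BUBBLE HALF OF THE LIMIT KERNEL IS `Decay510`** (some constant, some rate `> 0`): the dressed vertex is the chain-rule vertex of the co-dressed
limit stencils (`axVertexOfK_eq_vertexOfK_coProj`), a `VertexFamilyW` by `vertexFamilyW_vertexOfK` (`colW_of_decays`, `locStencilW_of_locStencil ∘ locStencil_coProj`);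
then asym1's `uniformDecay_halfS` at the CONSTANT families. -/
theorem exists_decay510_halfS_pinned (hLc : 2 ≤ Lc) (hr : r ∈ box (3 + 1) Lc) (cE cVH cΛ cB : ℝ)
    (Tc : Fin 4 → Fin 4 → Fin 4 → Fin 4 → ℝ) (μ ν : Fin 4) :
    ∃ C δ : ℝ, 0 < δ ∧ Decay510 (hessKer (axDressK Lc (limMKerOf fun j => unitK (sfStep Lc j) (smStep 3 Lc j) (KInvStep (d := 3) Lc j)))
      (axVertexOfK (limMKerOf fun j => unitK (sfStep Lc j) (smStep 3 Lc j) (KInvStep (d := 3) Lc j)) Lc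
        (limStOf fun j => unitS (sfStep Lc j) (smStep 3 Lc j) (JsBal0Of (one_le_of_two_le hLc) cE cVH cΛ (WbalOf 3 Lc cE cVH cΛ (T2Of 3 Lc cE cVH cΛ ((Lc : ℝ) ^ (2 * (3 + 1))) cB Tc (vh₂SAt (toSite r) Lc) (mixFFAt (toSite r) Lc)) (mixFFAt (toSite r) Lc))
          (CwOf (one_le_of_two_le hLc) cE cVH cΛ (T2Of_loc (one_le_of_two_le hLc) cE cVH cΛ ((Lc : ℝ) ^ (2 * (3 + 1))) cB Tc (hB_an1 (one_le_of_two_le hLc) hr) (hmix_an1 (one_le_of_two_le hLc) hr)) (hmix_an1 (one_le_of_two_le hLc) hr)) (δwOf (one_le_of_two_le hLc) cE cVH cΛ (T2Of_loc (one_le_of_two_le hLc) cE cVH cΛ ((Lc : ℝ) ^ (2 * (3 + 1))) cB Tc (hB_an1 (one_le_of_two_le hLc) hr) (hmix_an1 (one_le_of_two_le hLc) hr)) (hmix_an1 (one_le_of_two_le hLc) hr))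
          (δwOf_pos (one_le_of_two_le hLc) cE cVH cΛ (T2Of_loc (one_le_of_two_le hLc) cE cVH cΛ ((Lc : ℝ) ^ (2 * (3 + 1))) cB Tc (hB_an1 (one_le_of_two_le hLc) hr) (hmix_an1 (one_le_of_two_le hLc) hr)) (hmix_an1 (one_le_of_two_le hLc) hr)) (WbalOf_loc₂ (one_le_of_two_le hLc) cE cVH cΛ (T2Of_loc (one_le_of_two_le hLc) cE cVH cΛ ((Lc : ℝ) ^ (2 * (3 + 1))) cB Tc (hB_an1 (one_le_of_two_le hLc) hr) (hmix_an1 (one_le_of_two_le hLc) hr)) (hmix_an1 (one_le_of_two_le hLc) hr)) j).S))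
      0 μ ν) C δ := by
  obtain ⟨C, δK, Cs, δS, Cw, δW, R, hR, hRK, hRS, hRW, hK, hS, hW⟩ := exists_rows_limits_pinned hLc hr cE cVH cΛ cB Tc
  have hδK : 0 < δK := hR.trans hRK
  have hδS : 0 ≤ δS := by linarith
  have hA := decays_axDressK (one_le_of_two_le hLc) hK hδK.le
  have hV := vertexFamilyW_vertexOfK (colW_of_decays hK hRK) (locStencilW_of_locStencil (locStencil_coProj (one_le_of_two_le hLc) hS hδS) hRS) hR Lc
  have hU := uniformDecay_halfS (A := fun _ : ℕ => axDressK Lc (limMKerOf fun j => unitK (sfStep Lc j) (smStep 3 Lc j) (KInvStep (d := 3) Lc j)))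
    (N := Lc) (fun _ => colW_of_decays hA hRK) (fun _ => hV) hR.le μ ν
  have heq := axVertexOfK_eq_vertexOfK_coProj (N := Lc) (K := fun _ : ℕ => limMKerOf fun j => unitK (sfStep Lc j) (smStep 3 Lc j) (KInvStep (d := 3) Lc j))
    (S := fun _ : ℕ => limStOf fun j => unitS (sfStep Lc j) (smStep 3 Lc j) (JsBal0Of (one_le_of_two_le hLc) cE cVH cΛ (WbalOf 3 Lc cE cVH cΛ (T2Of 3 Lc cE cVH cΛ ((Lc : ℝ) ^ (2 * (3 + 1))) cB Tc (vh₂SAt (toSite r) Lc) (mixFFAt (toSite r) Lc)) (mixFFAt (toSite r) Lc))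
      (CwOf (one_le_of_two_le hLc) cE cVH cΛ (T2Of_loc (one_le_of_two_le hLc) cE cVH cΛ ((Lc : ℝ) ^ (2 * (3 + 1))) cB Tc (hB_an1 (one_le_of_two_le hLc) hr) (hmix_an1 (one_le_of_two_le hLc) hr)) (hmix_an1 (one_le_of_two_le hLc) hr)) (δwOf (one_le_of_two_le hLc) cE cVH cΛ (T2Of_loc (one_le_of_two_le hLc) cE cVH cΛ ((Lc : ℝ) ^ (2 * (3 + 1))) cB Tc (hB_an1 (one_le_of_two_le hLc) hr) (hmix_an1 (one_le_of_two_le hLc) hr)) (hmix_an1 (one_le_of_two_le hLc) hr))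
      (δwOf_pos (one_le_of_two_le hLc) cE cVH cΛ (T2Of_loc (one_le_of_two_le hLc) cE cVH cΛ ((Lc : ℝ) ^ (2 * (3 + 1))) cB Tc (hB_an1 (one_le_of_two_le hLc) hr) (hmix_an1 (one_le_of_two_le hLc) hr)) (hmix_an1 (one_le_of_two_le hLc) hr)) (WbalOf_loc₂ (one_le_of_two_le hLc) cE cVH cΛ (T2Of_loc (one_le_of_two_le hLc) cE cVH cΛ ((Lc : ℝ) ^ (2 * (3 + 1))) cB Tc (hB_an1 (one_le_of_two_le hLc) hr) (hmix_an1 (one_le_of_two_le hLc) hr)) (hmix_an1 (one_le_of_two_le hLc) hr)) j).S)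
    (one_le_of_two_le hLc) (fun _ => hK) hδK (fun _ => hS) hδS 0
  have hLc0 : (0 : ℝ) < (Lc : ℝ) := by exact_mod_cast (lt_of_lt_of_le zero_lt_two hLc)
  rw [heq]
  exact ⟨_, R * Lc, mul_pos hR hLc0, hU 0⟩

/-! ## §3 `M∞` is the sum of its tadpole half and its bubble half -/

/-- [folklore] **`M∞ = M∞ᵂ + M∞ˢ` AT THE PINNED LITERAL, HYPOTHESIS-FREE**: the closed-form limit second moment of gan24-p1's closing sentence (`= CauchyRate.lim β⁰`
by `Gaps/D1PinnedLimitClosedForm.lim_eq_closedForm_pinned`) is the second moment of the TADPOLE half `hessKer A∞ 0 W∞` (`= ½·Tr[A∞ ∘ W∞^{μν}(0,z)]`,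
`hessKer_zeroV`) plus that of the BUBBLE half `hessKer A∞ V∞ 0` (`= −½·Tr[(A∞∘V∞^μ(0))(A∞∘V∞^ν(z))]`, `hessKer_zeroW`), both absolutely convergent by §2
(`summable_coord2_mul_of_decay510`) — asym1's `secondMoment_eq_halves`.  The END-grade bit at this literal (`0 < M∞`) thus reads «`−M∞ˢ < M∞ᵂ`» on the two
words; neither is evaluated or signed here. -/
theorem closedForm_eq_halves_pinned (hLc : 2 ≤ Lc) (hr : r ∈ box (3 + 1) Lc) (cE cVH cΛ cB : ℝ)
    (Tc : Fin 4 → Fin 4 → Fin 4 → Fin 4 → ℝ) (μ ν : Fin 4) :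
    B12Beta.secondMoment (hessKer (axDressK Lc (limMKerOf fun j => unitK (sfStep Lc j) (smStep 3 Lc j) (KInvStep (d := 3) Lc j)))
        (axVertexOfK (limMKerOf fun j => unitK (sfStep Lc j) (smStep 3 Lc j) (KInvStep (d := 3) Lc j)) Lc
          (limStOf fun j => unitS (sfStep Lc j) (smStep 3 Lc j) (JsBal0Of (one_le_of_two_le hLc) cE cVH cΛ (WbalOf 3 Lc cE cVH cΛ (T2Of 3 Lc cE cVH cΛ ((Lc : ℝ) ^ (2 * (3 + 1))) cB Tc (vh₂SAt (toSite r) Lc) (mixFFAt (toSite r) Lc)) (mixFFAt (toSite r) Lc))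
            (CwOf (one_le_of_two_le hLc) cE cVH cΛ (T2Of_loc (one_le_of_two_le hLc) cE cVH cΛ ((Lc : ℝ) ^ (2 * (3 + 1))) cB Tc (hB_an1 (one_le_of_two_le hLc) hr) (hmix_an1 (one_le_of_two_le hLc) hr)) (hmix_an1 (one_le_of_two_le hLc) hr)) (δwOf (one_le_of_two_le hLc) cE cVH cΛ (T2Of_loc (one_le_of_two_le hLc) cE cVH cΛ ((Lc : ℝ) ^ (2 * (3 + 1))) cB Tc (hB_an1 (one_le_of_two_le hLc) hr) (hmix_an1 (one_le_of_two_le hLc) hr)) (hmix_an1 (one_le_of_two_le hLc) hr))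
            (δwOf_pos (one_le_of_two_le hLc) cE cVH cΛ (T2Of_loc (one_le_of_two_le hLc) cE cVH cΛ ((Lc : ℝ) ^ (2 * (3 + 1))) cB Tc (hB_an1 (one_le_of_two_le hLc) hr) (hmix_an1 (one_le_of_two_le hLc) hr)) (hmix_an1 (one_le_of_two_le hLc) hr)) (WbalOf_loc₂ (one_le_of_two_le hLc) cE cVH cΛ (T2Of_loc (one_le_of_two_le hLc) cE cVH cΛ ((Lc : ℝ) ^ (2 * (3 + 1))) cB Tc (hB_an1 (one_le_of_two_le hLc) hr) (hmix_an1 (one_le_of_two_le hLc) hr)) (hmix_an1 (one_le_of_two_le hLc) hr)) j).S))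
        (limTabOf fun j => unitW (sfStep Lc j) (smStep 3 Lc j) (WbalOf 3 Lc cE cVH cΛ (T2Of 3 Lc cE cVH cΛ ((Lc : ℝ) ^ (2 * (3 + 1))) cB Tc (vh₂SAt (toSite r) Lc) (mixFFAt (toSite r) Lc)) (mixFFAt (toSite r) Lc) j))) μ ν =
      B12Beta.secondMoment (hessKer (axDressK Lc (limMKerOf fun j => unitK (sfStep Lc j) (smStep 3 Lc j) (KInvStep (d := 3) Lc j))) 0
        (limTabOf fun j => unitW (sfStep Lc j) (smStep 3 Lc j) (WbalOf 3 Lc cE cVH cΛ (T2Of 3 Lc cE cVH cΛ ((Lc : ℝ) ^ (2 * (3 + 1))) cB Tc (vh₂SAt (toSite r) Lc) (mixFFAt (toSite r) Lc)) (mixFFAt (toSite r) Lc) j))) μ ν +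
      B12Beta.secondMoment (hessKer (axDressK Lc (limMKerOf fun j => unitK (sfStep Lc j) (smStep 3 Lc j) (KInvStep (d := 3) Lc j)))
        (axVertexOfK (limMKerOf fun j => unitK (sfStep Lc j) (smStep 3 Lc j) (KInvStep (d := 3) Lc j)) Lc
          (limStOf fun j => unitS (sfStep Lc j) (smStep 3 Lc j) (JsBal0Of (one_le_of_two_le hLc) cE cVH cΛ (WbalOf 3 Lc cE cVH cΛ (T2Of 3 Lc cE cVH cΛ ((Lc : ℝ) ^ (2 * (3 + 1))) cB Tc (vh₂SAt (toSite r) Lc) (mixFFAt (toSite r) Lc)) (mixFFAt (toSite r) Lc))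
            (CwOf (one_le_of_two_le hLc) cE cVH cΛ (T2Of_loc (one_le_of_two_le hLc) cE cVH cΛ ((Lc : ℝ) ^ (2 * (3 + 1))) cB Tc (hB_an1 (one_le_of_two_le hLc) hr) (hmix_an1 (one_le_of_two_le hLc) hr)) (hmix_an1 (one_le_of_two_le hLc) hr)) (δwOf (one_le_of_two_le hLc) cE cVH cΛ (T2Of_loc (one_le_of_two_le hLc) cE cVH cΛ ((Lc : ℝ) ^ (2 * (3 + 1))) cB Tc (hB_an1 (one_le_of_two_le hLc) hr) (hmix_an1 (one_le_of_two_le hLc) hr)) (hmix_an1 (one_le_of_two_le hLc) hr))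
            (δwOf_pos (one_le_of_two_le hLc) cE cVH cΛ (T2Of_loc (one_le_of_two_le hLc) cE cVH cΛ ((Lc : ℝ) ^ (2 * (3 + 1))) cB Tc (hB_an1 (one_le_of_two_le hLc) hr) (hmix_an1 (one_le_of_two_le hLc) hr)) (hmix_an1 (one_le_of_two_le hLc) hr)) (WbalOf_loc₂ (one_le_of_two_le hLc) cE cVH cΛ (T2Of_loc (one_le_of_two_le hLc) cE cVH cΛ ((Lc : ℝ) ^ (2 * (3 + 1))) cB Tc (hB_an1 (one_le_of_two_le hLc) hr) (hmix_an1 (one_le_of_two_le hLc) hr)) (hmix_an1 (one_le_of_two_le hLc) hr)) j).S))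
        0) μ ν := by
  obtain ⟨CW, δW, hδW, hdW⟩ := exists_decay510_halfW_pinned hLc hr cE cVH cΛ cB Tc μ ν
  obtain ⟨CS, δS, hδS, hdS⟩ := exists_decay510_halfS_pinned hLc hr cE cVH cΛ cB Tc μ ν
  refine secondMoment_eq_halves ?_ ?_
  · exact (summable_coord2_mul_of_decay510 hδW hdW μ ν).congr fun z => by ring
  · exact (summable_coord2_mul_of_decay510 hδS hdS μ ν).congr fun z => by ring

end Summit.QuantumFields.BalabanUV.Gaps.D1PinnedClosedFormHalves

end
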